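import Summits.NavierStokesRegularity.FunctionalMining.StrainMoment
import Literature.Analysis.FluidPDE.ExtremeGrowthBoundsProofs

/-!
# Transport of saturating laws along functional identities; rows `E.q=2` and `ES.absS.q=2` literal

Search for candidate a priori estimates; no regularity claim.

A saturating law `dF/dt ≤ κ ν^{-γ} (2ℰ) F^{1+1/σ}` (`SaturatingLaw F σ γ κ`) only ever evaluates
`F` on smooth divergence-free fields (the time slices of a classical solution), so it transports
along any identity `G = c · F` valid on such fields, with the rate constant rescaled to
`c^{−1/σ} κ` (`SaturatingLaw.of_eq_const_mul`). Two K0 rows are thereby kernel statements about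
the functional the matrix names, not only about the enstrophy `ℰ = ½‖∇u‖₂²`:

* row `E.q=2|T_LD|G1` — `Z₂ = ∫|ω|² = torusVorticityMoment 2 = 2ℰ` on smooth divergence-free fields
  (`torusVorticityMoment_two`): `SaturatingLaw (torusVorticityMoment 2) 1 3 (27/(32π⁴))`
  (`vorticityMoment_two_saturatingLaw`), from the tree's Lu–Doering theorem
  `LuDoering2008_enstrophyRate_le_holds` via `saturatingLaw_enstrophy_iff`;
* row `ES.absS.q=2|T_LD|G1` — `∫|S|² = torusStrainMoment 2 = ℰ` (`torusStrainMoment_two`):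
  `SaturatingLaw (torusStrainMoment 2) 1 3 (27/(16π⁴))` (`strainMoment_two_saturatingLaw`).

## Main statements

* `SaturatingLaw.of_eq_const_mul` — transport along `G = c · F` on smooth divergence-free fields.
* `saturatingLaw_enstrophy` — the unconditional enstrophy law `SaturatingLaw ℰ 1 3 (27/(16π⁴))`.
* `vorticityMoment_two_saturatingLaw`, `strainMoment_two_saturatingLaw` — the two rows.
-/

noncomputable section

open MeasureTheory Set

namespace Summit.NavierStokesRegularity.FunctionalMining

open Literature.Analysis.FunctionSpaces Literature.Analysis.FluidPDE

variable {d : Type*} [Fintype d] [DecidableEq d]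

/-- **Transport of a saturating law along `G = c · F`.** If `G v = c · F v` for every smooth
divergence-free field `v`, with `c > 0` and `F ≥ 0`, then `SaturatingLaw F σ γ κ` implies
`SaturatingLaw G σ γ (c^{−1/σ} κ)`: along a classical solution the slices are smooth and
divergence-free, so `t ↦ G(u t) = c F(u t)` on the window, the one-sided derivatives scale by `c`,
and `c · F^{1+1/σ} = c^{−1/σ} (cF)^{1+1/σ}`. [folklore] -/
theorem SaturatingLaw.of_eq_const_mul
    {F G : (UnitAddTorus d → EuclideanSpace ℝ d) → ℝ} {σ γ κ c : ℝ}
    (h : SaturatingLaw (d := d) F σ γ κ) (hc : 0 < c) (hF : ∀ v, 0 ≤ F v)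
    (hFG : ∀ v, Torus.IsSmooth v → Torus.IsDivFree v → G v = c * F v) :
    SaturatingLaw (d := d) G σ γ (c ^ (-σ⁻¹) * κ) := by
  intro hd ν hν a b hab u p hsol hmean t ht
  obtain ⟨hdiff, hle⟩ := h hd hν hab hsol hmean t ht
  -- on the window, `G (u s) = c * F (u s)`
  have hEq : EqOn (fun s => G (u s)) (fun s => c * F (u s)) (Icc a b) := fun s hs =>
    hFG (u s) (hsol.smooth_velocity.isSmooth_slice hs) (hsol.divFree s hs)
  have hdiff' : DifferentiableWithinAt ℝ (fun s => c * F (u s)) (Icc a b) t :=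
    hdiff.const_mul c
  refine ⟨hdiff'.congr hEq (hEq ht), ?_⟩
  have hle' : derivWithin (fun s => F (u s)) (Icc a b) t ≤
      κ * ν ^ (-γ) * (2 * torusEnstrophy (u t)) * F (u t) ^ (1 + σ⁻¹) := hle
  have hder' : HasDerivWithinAt (fun s => c * F (u s))
      (c * derivWithin (fun s => F (u s)) (Icc a b) t) (Icc a b) t :=
    hdiff.hasDerivWithinAt.const_mul c
  rw [derivWithin_congr hEq (hEq ht), hder'.derivWithin (uniqueDiffOn_Icc hab t ht)]
  show c * derivWithin (fun s => F (u s)) (Icc a b) t ≤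
    c ^ (-σ⁻¹) * κ * ν ^ (-γ) * (2 * torusEnstrophy (u t)) * G (u t) ^ (1 + σ⁻¹)
  -- `c · F' ≤ c κ ν^{-γ} (2ℰ) F^{1+1/σ} = (c^{-1/σ} κ) ν^{-γ} (2ℰ) (cF)^{1+1/σ}`
  have hpow : (c * F (u t)) ^ (1 + σ⁻¹) = c * c ^ σ⁻¹ * F (u t) ^ (1 + σ⁻¹) := by
    rw [Real.mul_rpow hc.le (hF _), Real.rpow_add hc, Real.rpow_one]
  have hcc : c ^ (-σ⁻¹) * c ^ σ⁻¹ = 1 := by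
    rw [← Real.rpow_add hc, neg_add_cancel, Real.rpow_zero]
  have hG : G (u t) = c * F (u t) := hEq ht
  rw [hG, hpow]
  have hrhs : c ^ (-σ⁻¹) * κ * ν ^ (-γ) * (2 * torusEnstrophy (u t)) *
      (c * c ^ σ⁻¹ * F (u t) ^ (1 + σ⁻¹)) =
      c * (c ^ (-σ⁻¹) * c ^ σ⁻¹) * (κ * ν ^ (-γ) * (2 * torusEnstrophy (u t)) *
        F (u t) ^ (1 + σ⁻¹)) := by ring
  rw [hrhs, hcc, mul_one]
  exact mul_le_mul_of_nonneg_left hle' hc.le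

/-- **The enstrophy saturating law, unconditional** (row `E.q=2|T_LD|G1` in `ℰ`-units):
`SaturatingLaw ℰ 1 3 (27/(16π⁴))`, i.e. `dℰ/dt ≤ (27/(8π⁴ν³)) ℰ³` — the tree's Lu–Doering theorem
`LuDoering2008_enstrophyRate_le_holds` read through `saturatingLaw_enstrophy_iff`. [folklore] -/
theorem saturatingLaw_enstrophy :
    SaturatingLaw (d := d) torusEnstrophy 1 3 (27 / (16 * Real.pi ^ 4)) :=
  saturatingLaw_enstrophy_iff.2 LuDoering2008_enstrophyRate_le_holds

/-- **Row `E.q=2|T_LD|G1` literally, for `Z₂ = ∫|ω|²`:**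
`SaturatingLaw (torusVorticityMoment 2) 1 3 (27/(32π⁴))` — `d/dt Z₂ ≤ (27/(32π⁴)) ν⁻³ (2ℰ) Z₂²`
along every zero-mean classical solution of unforced Navier–Stokes on `T³`; transport of the
enstrophy law along `Z₂ = 2ℰ` (`torusVorticityMoment_two`), `κ ↦ 2⁻¹κ`. [folklore] -/
theorem vorticityMoment_two_saturatingLaw :
    SaturatingLaw (d := d) (torusVorticityMoment 2) 1 3 (27 / (32 * Real.pi ^ 4)) := by
  have h := (saturatingLaw_enstrophy (d := d)).of_eq_const_mul (G := torusVorticityMoment 2)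
    (c := 2) two_pos torusEnstrophy_nonneg
    (fun v hv hdiv => torusVorticityMoment_two hv hdiv)
  have h2 : (2 : ℝ) ^ (-(1 : ℝ)⁻¹) * (27 / (16 * Real.pi ^ 4)) = 27 / (32 * Real.pi ^ 4) := by
    rw [inv_one, Real.rpow_neg_one]
    ring
  rwa [h2] at h

/-- **Row `ES.absS.q=2|T_LD|G1` literally, for `∫|S|²`:**
`SaturatingLaw (torusStrainMoment 2) 1 3 (27/(16π⁴))` — `d/dt ∫|S|² ≤ (27/(16π⁴)) ν⁻³ (2ℰ) (∫|S|²)²`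
along every zero-mean classical solution of unforced Navier–Stokes on `T³`; transport of the
enstrophy law along `∫|S|² = ℰ` (`torusStrainMoment_two`). [folklore] -/
theorem strainMoment_two_saturatingLaw :
    SaturatingLaw (d := d) (torusStrainMoment 2) 1 3 (27 / (16 * Real.pi ^ 4)) := by
  have h := (saturatingLaw_enstrophy (d := d)).of_eq_const_mul (G := torusStrainMoment 2)
    (c := 1) one_pos torusEnstrophy_nonneg
    (fun v hv hdiv => by rw [one_mul]; exact torusStrainMoment_two hv hdiv)
  have h1 : (1 : ℝ) ^ (-(1 : ℝ)⁻¹) * (27 / (16 * Real.pi ^ 4)) = 27 / (16 * Real.pi ^ 4) := by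
    rw [Real.one_rpow, one_mul]
  rwa [h1] at h

end Summit.NavierStokesRegularity.FunctionalMining
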